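import Literature.Geometry.DiscreteGeometry.KissingContactCount
import HarnessLib

/-!
# The main estimate (Hales Thm 2, `d₃`) and the census `≥ 23 contacts` — K25 copy at `κ = 7/32` (`h = 5/4`), part 1/4

HONEST FRAMING (cell pub-crystal3d, K-path at `h = 5/4`): this is NOT a result printed by Hales.  It is his
METHOD (arXiv:1209.6043, Theorem 3: the main estimate + the classification of the contact graphs of kissing
configurations, in the tree's form of a verified interval-arithmetic growth search, `Literature/…/KissingSearch*.lean`)
RE-RUN at the separation `5/2` instead of `2h₀ = 2.52` (largest long-side cosine `κ = 1 − (5/4)²/2 = 7/32` instead of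
`κ₀ = 1031/5000`).  The declarations are namespace-shadowing COPIES of the tree's declarations (same names, inside
`namespace Summit.Ventures.Crystal3D.Kissing125[.KissingSearch]`, original docstrings and citation tags kept — the tags
name the printed METHOD step each declaration implements); the diff to the originals is stated per file.  Generated by
`HOME/lean/kissing125/gen/mkfiles.py`; audit recipe in `HOME/lean/kissing125/README.md`.  Nothing here is asserted
about GAP(1.26) or any census.

THIS FILE: the κ-DEPENDENT declarations of `KissingMainEstimate` / `KissingFacetPenalty` / `KissingFacetPenaltyRefined` / `KissingTriangleDeficit` / `KissingContactCount` with `1031/5000 ↦ 7/32`, the `d₃` constants `0.103/0.27/0.36/0.5/0.63 ↦ 0.1/0.26/0.34/0.475/0.61` (corner principle on the new boxes; rational waypoints `575/2808`, `0.312`, `0.373`, `0.484`, `0.607`; `0.49` unchanged), the unit price `0.103 ↦ 0.1`, and the budget `1.62 ↦ 1.56` via the new `lt_hales_sol0_5504` (`sol₀ > 0.5504`, two half-angle steps) / `budget_lt_156`; `fanPenaltyLB_eq` re-proved for the shadowing `fanPenaltyLB`. κ-independent lemmas (`contactCount`, `triangleUnits`, deficits/supplies, `EdgeDeficit`, `FanCensus`,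 `ContactCount` A–B, …) are the tree's, unchanged. Headline: `twentythree_le_card_contactPairsAt` at `7/32`.  (Part 1 of 4: lines 1–182 of the transformed copy; the split is only for the 400-line rule.)

## References
* T. C. Hales, *A proof of Fejes Tóth's conjecture on sphere packings with kissing number twelve*,
  arXiv:1209.6043 (2012): Definition 1, Theorem 2 (main estimate `d₃`), Theorem 3, Lemmas 7–10. [`Hales2012`]
* R. E. Moore, *Interval Analysis* (1966), Theorem 3.1, §4.4. [`Moore1966`]
-/

noncomputable section

namespace Summit.Ventures.Crystal3D.Kissing125

open Literature.Geometry.DiscreteGeometry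
open Real RealInnerProductSpace InnerProductGeometry Finset

/-! ## K25 port of the main estimate (Hales 2012 Thm 2) at κ = 7/32 — constants 0.1 / 0.26 / 0.34 / 0.475 / 0.61 -/


section Estimates


variable {a b c : (EuclideanSpace ℝ (Fin 3))}

/-- **Case `(2,1,0)` at `κ = 7/32`: `E ≥ sol₀ + 0.1`** for an isosceles contact triangle whose third edge has
length in `[5/2, 3.0]` on `S²(2)`, i.e. `−1/8 ≤ ⟪b, c⟫ ≤ 7/32` on the unit sphere.
By the endpoint principle the minimum of `F(x, ½, ½)` on `[−1/8, κ₀]` is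
`min (3/14, F(7/32,½,½)) = F(7/32,½,½) = 575/2808 ≈ 0.20477 ≥ 1 − cos (sol₀ + 0.1)` (K25 constant; Hales's
`d₃(2,1,0) = 0.103` is the value at `κ₀`). [cite: Hales2012, Theorem 2 (d₃(2,1,0); method at κ = 7/32)] -/
theorem sol0_add_le_sphExcess_of_isosceles_short (ha : ‖a‖ = 1) (hb : ‖b‖ = 1) (hc : ‖c‖ = 1)
    (hli : LinearIndependent ℝ ![a, b, c]) (hab : ⟪a, b⟫ = 1 / 2) (hac : ⟪a, c⟫ = 1 / 2)
    (h₁ : -1 / 8 ≤ ⟪b, c⟫) (h₂ : ⟪b, c⟫ ≤ 7 / 32) :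
    hales_sol0 + 0.1 ≤ sphExcess a b c := by
  apply le_sphExcess_of_one_sub_cos_le ha hb hc hli
    (by linarith [hales_sol0_le_pi_div_two, pi_gt_three])
  rw [hac, hab]
  have hm := min_eulerF_le₁ (x := ⟪b, c⟫) (y := 1 / 2) (z := 1 / 2) (x₁ := -1 / 8)
    (x₂ := 7 / 32) (by norm_num) (by norm_num) (by norm_num) h₁ h₂
  have e1 : eulerF (-1 / 8) (1 / 2) (1 / 2) = 3 / 14 := by norm_num [eulerF, eulerGram]
  have e2 : eulerF (7 / 32) (1 / 2) (1 / 2) = 575 / 2808 := by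
    norm_num [eulerF, eulerGram]
  rw [e1, e2, min_eq_right (by norm_num)] at hm
  have hb := one_sub_cos_sol0_add_le (d := 0.1) (by norm_num) (by norm_num)
  refine le_trans hb (le_trans ?_ hm)
  norm_num

/-- **Case `(1,·,·)` at `κ = 7/32`: `E ≥ sol₀ + 0.26`** for a triangle with one contact edge `⟪a, b⟫ = 1/2`
and two long edges (`⟪a, c⟫, ⟪b, c⟫ ∈ [−1/2, κ₀]`): the printed `d₃(1,2,0) = 0.27`, here for
all `(1, s, t)` from the edge ranges alone.  Corner principle on the box `[−1/2, κ₀]²`: the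
least corner value is `F(7/32, 7/32, ½) ≈ 0.3151 ≥ 0.312 ≥ 1 − cos (sol₀ + 0.26)` (Hales: `0.27` at `κ₀`).
[cite: Hales2012, Theorem 2 (d₃(1,2,0) = 0.27)] -/
theorem sol0_add_le_sphExcess_of_one_contact (ha : ‖a‖ = 1) (hb : ‖b‖ = 1) (hc : ‖c‖ = 1)
    (hli : LinearIndependent ℝ ![a, b, c]) (hab : ⟪a, b⟫ = 1 / 2)
    (hac : -1 / 2 ≤ ⟪a, c⟫ ∧ ⟪a, c⟫ ≤ 7 / 32) (hbc : -1 / 2 ≤ ⟪b, c⟫ ∧ ⟪b, c⟫ ≤ 7 / 32) :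
    hales_sol0 + 0.26 ≤ sphExcess a b c := by
  apply le_sphExcess_of_one_sub_cos_le ha hb hc hli
    (by linarith [hales_sol0_le_pi_div_two, pi_gt_three])
  rw [hab]
  have hb := one_sub_cos_sol0_add_le (d := 0.26) (by norm_num) (by norm_num)
  refine le_trans hb (le_trans (show _ ≤ (312 / 1000 : ℝ) by norm_num) ?_)
  refine le_eulerF_of_corners₂ (by norm_num) (by norm_num) (by norm_num) hbc hac ?_
  intro x' hx' y' hy'
  simp only [Set.mem_insert_iff, Set.mem_singleton_iff] at hx' hy'
  rcases hx' with rfl | rfl <;> rcases hy' with rfl | rfl <;> norm_num [eulerF, eulerGram]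

/-- **Case `(1,·,·)` with a very long edge, at `κ = 7/32`: `E ≥ sol₀ + 0.34`** if in addition `⟪b, c⟫ ≤ 0`
(length `≥ 2√2` on `S²(2)`).  Corner principle on `[−1/2, 0] × [−1/2, κ₀]`: least corner value
`F(0, 7/32, ½) = 0.375 ≥ 0.373 ≥ 1 − cos (sol₀ + 0.34)` (tree: `0.36` at `κ₀`).
[cite: Hales2012, Theorem 2 (proof, cases (1,s,t))] -/
theorem sol0_add_le_sphExcess_of_one_contact_of_nonpos (ha : ‖a‖ = 1) (hb : ‖b‖ = 1)
    (hc : ‖c‖ = 1) (hli : LinearIndependent ℝ ![a, b, c]) (hab : ⟪a, b⟫ = 1 / 2)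
    (hac : -1 / 2 ≤ ⟪a, c⟫ ∧ ⟪a, c⟫ ≤ 7 / 32) (hbc : -1 / 2 ≤ ⟪b, c⟫ ∧ ⟪b, c⟫ ≤ 0) :
    hales_sol0 + 0.34 ≤ sphExcess a b c := by
  apply le_sphExcess_of_one_sub_cos_le ha hb hc hli
    (by linarith [hales_sol0_le_pi_div_two, pi_gt_three])
  rw [hab]
  have hb := one_sub_cos_sol0_add_le (d := 0.34) (by norm_num) (by norm_num)
  refine le_trans hb (le_trans (show _ ≤ (373 / 1000 : ℝ) by norm_num) ?_)
  refine le_eulerF_of_corners₂ (by norm_num) (by norm_num) (by norm_num) hbc hac ?_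
  intro x' hx' y' hy'
  simp only [Set.mem_insert_iff, Set.mem_singleton_iff] at hx' hy'
  rcases hx' with rfl | rfl <;> rcases hy' with rfl | rfl <;> norm_num [eulerF, eulerGram]

/-- **Case `(0,·,·)`: `E ≥ sol₀ + 0.5`** for a triangle with three long edges
(`⟪·,·⟫ ∈ [−1/2, κ₀]`) whose sum of edge-cosines is `> −3/4` (on every Delaunay triangle it is
`> −3/8`, `sum_inner_ge_of_common_cap`) — sharper than the printed `d₃(0,3,0) = 0.437`.  The
extra hypothesis only removes the degenerate corner `(−1/2, −1/2, −1/2)` of the box (three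
coplanar directions); on the three sub-boxes `[−1/4, κ₀] × [−1/2, κ₀]²`,
`[−1/2,−1/4] × [−1/4, κ₀] × [−1/2, κ₀]`, `[−1/2,−1/4]² × [−1/4, κ₀]` covering the rest, the least
corner value is `F(7/32, 7/32, 7/32) ≈ 0.4847 ≥ 0.484 ≥ 1 − cos (sol₀ + 0.475)` (tree: `0.5` at `κ₀`).
[cite: Hales2012, Theorem 2 (d₃(0,s,t))] -/
theorem sol0_add_le_sphExcess_of_no_contact (ha : ‖a‖ = 1) (hb : ‖b‖ = 1) (hc : ‖c‖ = 1)
    (hli : LinearIndependent ℝ ![a, b, c]) (hbc : -1 / 2 ≤ ⟪b, c⟫ ∧ ⟪b, c⟫ ≤ 7 / 32)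
    (hac : -1 / 2 ≤ ⟪a, c⟫ ∧ ⟪a, c⟫ ≤ 7 / 32) (hab : -1 / 2 ≤ ⟪a, b⟫ ∧ ⟪a, b⟫ ≤ 7 / 32)
    (hsum : -3 / 4 < ⟪b, c⟫ + ⟪a, c⟫ + ⟪a, b⟫) :
    hales_sol0 + 0.475 ≤ sphExcess a b c := by
  apply le_sphExcess_of_one_sub_cos_le ha hb hc hli
    (by linarith [hales_sol0_le_pi_div_two, pi_gt_three])
  have hb := one_sub_cos_sol0_add_le (d := 0.475) (by norm_num) (by norm_num)
  refine le_trans hb (le_trans (show _ ≤ (484 / 1000 : ℝ) by norm_num) ?_)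
  set x := ⟪b, c⟫ with hx
  set y := ⟪a, c⟫ with hy
  set z := ⟪a, b⟫ with hz
  rcases le_or_gt (-1 / 4) x with hx4 | hx4
  · refine le_eulerF_of_corners₃ (x₁ := -1 / 4) (x₂ := 7 / 32) (y₁ := -1 / 2)
      (y₂ := 7 / 32) (z₁ := -1 / 2) (z₂ := 7 / 32) (by norm_num) (by norm_num)
      (by norm_num) ⟨hx4, hbc.2⟩ hac hab ?_
    intro x' hx' y' hy' z' hz'
    simp only [Set.mem_insert_iff, Set.mem_singleton_iff] at hx' hy' hz'
    rcases hx' with rfl | rfl <;> rcases hy' with rfl | rfl <;> rcases hz' with rfl | rfl <;>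
      norm_num [eulerF, eulerGram]
  rcases le_or_gt (-1 / 4) y with hy4 | hy4
  · refine le_eulerF_of_corners₃ (x₁ := -1 / 2) (x₂ := -1 / 4) (y₁ := -1 / 4)
      (y₂ := 7 / 32) (z₁ := -1 / 2) (z₂ := 7 / 32) (by norm_num) (by norm_num)
      (by norm_num) ⟨hbc.1, hx4.le⟩ ⟨hy4, hac.2⟩ hab ?_
    intro x' hx' y' hy' z' hz'
    simp only [Set.mem_insert_iff, Set.mem_singleton_iff] at hx' hy' hz'
    rcases hx' with rfl | rfl <;> rcases hy' with rfl | rfl <;> rcases hz' with rfl | rfl <;>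
      norm_num [eulerF, eulerGram]
  have hz4 : -1 / 4 ≤ z := by linarith
  refine le_eulerF_of_corners₃ (x₁ := -1 / 2) (x₂ := -1 / 4) (y₁ := -1 / 2) (y₂ := -1 / 4)
    (z₁ := -1 / 4) (z₂ := 7 / 32) (by norm_num) (by norm_num) (by norm_num)
    ⟨hbc.1, hx4.le⟩ ⟨hac.1, hy4.le⟩ ⟨hz4, hab.2⟩ ?_
  intro x' hx' y' hy' z' hz'
  simp only [Set.mem_insert_iff, Set.mem_singleton_iff] at hx' hy' hz'
  rcases hx' with rfl | rfl <;> rcases hy' with rfl | rfl <;> rcases hz' with rfl | rfl <;>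
    norm_num [eulerF, eulerGram]

/-- **Case `(0,·,·)` with a very long edge, at `κ = 7/32`: `E ≥ sol₀ + 0.61`** if in addition `⟪b, c⟫ ≤ 0`
(least corner value `F(0, 7/32, 7/32) ≈ 0.6088 ≥ 0.607 ≥ 1 − cos (sol₀ + 0.61)`, same sub-boxes
with `κ₀` replaced by `0` in the first coordinate). [cite: Hales2012, Theorem 2 (d₃(0,s,t))] -/
theorem sol0_add_le_sphExcess_of_no_contact_of_nonpos (ha : ‖a‖ = 1) (hb : ‖b‖ = 1)
    (hc : ‖c‖ = 1) (hli : LinearIndependent ℝ ![a, b, c]) (hbc : -1 / 2 ≤ ⟪b, c⟫ ∧ ⟪b, c⟫ ≤ 0)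
    (hac : -1 / 2 ≤ ⟪a, c⟫ ∧ ⟪a, c⟫ ≤ 7 / 32) (hab : -1 / 2 ≤ ⟪a, b⟫ ∧ ⟪a, b⟫ ≤ 7 / 32)
    (hsum : -3 / 4 < ⟪b, c⟫ + ⟪a, c⟫ + ⟪a, b⟫) :
    hales_sol0 + 0.61 ≤ sphExcess a b c := by
  apply le_sphExcess_of_one_sub_cos_le ha hb hc hli
    (by linarith [hales_sol0_le_pi_div_two, pi_gt_three])
  have hb := one_sub_cos_sol0_add_le (d := 0.61) (by norm_num) (by norm_num)
  refine le_trans hb (le_trans (show _ ≤ (607 / 1000 : ℝ) by norm_num) ?_)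
  set x := ⟪b, c⟫ with hx
  set y := ⟪a, c⟫ with hy
  set z := ⟪a, b⟫ with hz
  rcases le_or_gt (-1 / 4) x with hx4 | hx4
  · refine le_eulerF_of_corners₃ (x₁ := -1 / 4) (x₂ := 0) (y₁ := -1 / 2)
      (y₂ := 7 / 32) (z₁ := -1 / 2) (z₂ := 7 / 32) (by norm_num) (by norm_num)
      (by norm_num) ⟨hx4, hbc.2⟩ hac hab ?_
    intro x' hx' y' hy' z' hz'
    simp only [Set.mem_insert_iff, Set.mem_singleton_iff] at hx' hy' hz'
    rcases hx' with rfl | rfl <;> rcases hy' with rfl | rfl <;> rcases hz' with rfl | rfl <;>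
      norm_num [eulerF, eulerGram]
  rcases le_or_gt (-1 / 4) y with hy4 | hy4
  · refine le_eulerF_of_corners₃ (x₁ := -1 / 2) (x₂ := -1 / 4) (y₁ := -1 / 4)
      (y₂ := 7 / 32) (z₁ := -1 / 2) (z₂ := 7 / 32) (by norm_num) (by norm_num)
      (by norm_num) ⟨hbc.1, hx4.le⟩ ⟨hy4, hac.2⟩ hab ?_
    intro x' hx' y' hy' z' hz'
    simp only [Set.mem_insert_iff, Set.mem_singleton_iff] at hx' hy' hz'
    rcases hx' with rfl | rfl <;> rcases hy' with rfl | rfl <;> rcases hz' with rfl | rfl <;>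
      norm_num [eulerF, eulerGram]
  have hz4 : -1 / 4 ≤ z := by linarith
  refine le_eulerF_of_corners₃ (x₁ := -1 / 2) (x₂ := -1 / 4) (y₁ := -1 / 2) (y₂ := -1 / 4)
    (z₁ := -1 / 4) (z₂ := 7 / 32) (by norm_num) (by norm_num) (by norm_num)
    ⟨hbc.1, hx4.le⟩ ⟨hac.1, hy4.le⟩ ⟨hz4, hab.2⟩ ?_
  intro x' hx' y' hy' z' hz'
  simp only [Set.mem_insert_iff, Set.mem_singleton_iff] at hx' hy' hz'
  rcases hx' with rfl | rfl <;> rcases hy' with rfl | rfl <;> rcases hz' with rfl | rfl <;>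
    norm_num [eulerF, eulerGram]

end Estimates


/-- **The constant of the main estimate for a Delaunay triangle from its three side cosines**
(a side is a contact iff its cosine is `1/2`; "very long" means negative cosine, i.e. length
`> 2√2` on `S²(2)`), K25 constants at `κ = 7/32`: `0` for three contacts; `0.1` for two contacts unless the third side is
very long (then `0` — Hales's sharp case `(2,0,1)`); `0.27` for one contact, `0.36` if some side
is very long; `0.5` for no contact, `0.63` if some side is very long.
[cite: Hales2012, Theorem 2 (the function d₃)] -/
def trianglePenaltyLB (x y z : ℝ) : ℝ :=
  if contactCount x y z = 3 then 0
  else if contactCount x y z = 2 then (if x < 0 ∨ y < 0 ∨ z < 0 then 0 else 0.1)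
  else if contactCount x y z = 1 then (if x < 0 ∨ y < 0 ∨ z < 0 then 0.34 else 0.26)
  else (if x < 0 ∨ y < 0 ∨ z < 0 then 0.61 else 0.475)

/-- `trianglePenaltyLB` is nonnegative. [folklore] -/
theorem trianglePenaltyLB_nonneg (x y z : ℝ) : 0 ≤ trianglePenaltyLB x y z := by
  unfold trianglePenaltyLB
  split_ifs <;> norm_num

section Estimate

end Estimate
end Summit.Ventures.Crystal3D.Kissing125
end
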